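import Literature.AlgebraicGeometry.Modules.TensorProductLocallyFree
import Literature.AlgebraicGeometry.Modules.DetClassOfIso
import Literature.AlgebraicGeometry.Modules.FrameMatrixEnd
import HarnessLib

/-!
# Rank and determinant class of a tensor product of locally free modules

For finite locally free `𝒪_X`-modules `M`, `N` of ranks `r`, `r'` on a scheme `X`:

* `exists_frame_prod_tensorObj` — over a common frame neighbourhood `U` of `x`, with frames
  `b : I → Γ(M, U)`, `c : K → Γ(N, U)`, the sections `η_U(b_i ⊗ c_j)`, `(i, j) ∈ I × K`, form a
  frame of `M ⊗ N` over `U` (the content of the proof of Stacks 01CE (7) in the tree's frame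
  language, `Modules/TensorProductLocallyFree.isFiniteLocallyFree_tensorObj`, with the index types
  KEPT so that ranks can be read off);
* `exists_frameSystem_tensorObj` — frame systems `F_M`, `F_N` of `M`, `N` give a frame system of
  `M ⊗ N` with index types `I_M(x) × I_N(x)` and ranks `rank_M(x) · rank_N(x)`;
* **`hasRank_tensorObj`** — `HasRank M r → HasRank N r' → HasRank (M ⊗ N) (r r')`
  (Stacks 01CE (7) with ranks; Hartshorne II Ex. 5.16).

* `basisSection_frame_bijective`, `exists_frame_basisSection_eq` — the basis sections of a frame
  form a frame; conversely sections forming a frame over `W` (with `E|_W` free on the same finite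
  index type) ARE the basis sections of a trivialisation `𝒪^I ≅ E|_W` (invertible matrix in a
  frame, `Modules/FrameMatrixEnd`);
* `exists_frame_tensorObj_basisSection_eq` — a frame of `M ⊗ N` over `U` whose basis sections are
  the `η_U(b_i ⊗ c_j)`;
* `FrameSystem.exists_tensorObj_cocycle_equiv_mul` — for RANK-ONE frame systems the tensor frame
  system has cocycle `g^M_{xy} g^N_{xy}` (bilinearity: `η(b_y ⊗ c_y) = g^M g^N η(b_x ⊗ c_x)`);
* **`detClass_tensorObj_of_hasRank_one`** (and the primed form with the canonical witnesses) —
  `[det (L ⊗ L')] = [det L] · [det L']` in `Ȟ¹(X, 𝒪_X^×)` for `L`, `L'` of rank one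
  (Hartshorne II Ex. 6.11 / Ex. 5.16 (d)).

Everything here is proved; no named facts.

## References

* The Stacks Project, Tag 01CE (Modules, Lemma 17.16.6 (7)). [StacksProject]
* R. Hartshorne, *Algebraic Geometry*, GTM 52 (1977), II.5 p. 109, II Ex. 5.16. [Hartshorne1977]
-/

noncomputable section

open CategoryTheory CategoryTheory.Limits AlgebraicGeometry TopologicalSpace Opposite
open Literature.AlgebraicGeometry.Motives
open Literature.AlgebraicGeometry.FormalGeometry.WittGrothendieckExistence.FormalVectorBundlesAlgebraize
open Literature.AlgebraicGeometry.KTheory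

universe u

namespace Literature.AlgebraicGeometry.Modules

variable {X : Scheme.{u}} (M N : X.Modules)

/-- **A frame of `M ⊗ N` indexed by `I × K` from frames of `M` and `N` over a common open `U`**:
the sections `η_U(b_i ⊗ c_j)` (proof of `isFiniteLocallyFree_tensorObj`, with the index type kept).
[cite: StacksProject, Tag 01CE (Lemma 17.16.6 (7), proof)] -/
theorem exists_frame_prod_tensorObj {U : X.Opens} {I K : Type u} [Fintype I] [Fintype K]
    (F : FramePair M N U I K) :
    ∃ t : I × K → Γ(tensorObj M N, U), ∀ (V : X.Opens) (hV : V ≤ U),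
      Function.Bijective fun a : I × K → Γ(X, V) =>
        ∑ p, a p • (tensorObj M N).presheaf.map (homOfLE hV).op (t p) := by
  refine ⟨fun p => (tensorUnitHom M N).app (op U) (F.basis U le_rfl p), fun V hV => ?_⟩
  have key : (fun a : I × K → Γ(X, V) =>
      ∑ p, a p • (tensorObj M N).presheaf.map (homOfLE hV).op
        ((tensorUnitHom M N).app (op U) (F.basis U le_rfl p))) =
      (fun q => (tensorUnitHom M N).app (op V) q) ∘ fun a : I × K → secRing X V =>
        ∑ p, a p • F.basis V hV p := by
    funext a
    simp only [Function.comp_apply]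
    rw [tensorUnitHom_app_sum]
    refine Finset.sum_congr rfl fun p _ => ?_
    rw [map_tensorUnitHom_app, F.resT_basis, tensorUnitHom_app_smul]
    rfl
  have hbij : Function.Bijective fun a : I × K → secRing X V => ∑ p, a p • F.basis V hV p := by
    have hsymm : (fun a : I × K → secRing X V => ∑ p, a p • F.basis V hV p) =
        ⇑(F.basis V hV).equivFun.symm :=
      funext fun a => ((F.basis V hV).equivFun_symm_apply a).symm
    rw [hsymm]
    exact (F.basis V hV).equivFun.symm.bijective
  rw [key]
  exact (tensorUnitHom_app_bijective M N F V hV).comp hbij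

/-- **A frame pair over `U_M(x) ∩ U_N(x)` from frame systems of `M` and `N`**, with the index types
of the frame systems (restrict the two frames to the intersection).
[cite: Hartshorne1977, II.5 p. 109 (locally free sheaves)] -/
theorem nonempty_framePair_of_frameSystem (FM : FrameSystem M) (FN : FrameSystem N) (x : X) :
    letI : Fintype (FM.I x) := Fintype.ofEquiv _ (FM.enum x).symm
    letI : Fintype (FN.I x) := Fintype.ofEquiv _ (FN.enum x).symm
    Nonempty (FramePair M N (FM.U x ⊓ FN.U x) (FM.I x) (FN.I x)) := by
  letI : Fintype (FM.I x) := Fintype.ofEquiv _ (FM.enum x).symm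
  letI : Fintype (FN.I x) := Fintype.ofEquiv _ (FN.enum x).symm
  obtain ⟨eM⟩ := nonempty_restrictIso_of_overIso (FM.frame x)
  obtain ⟨eN⟩ := nonempty_restrictIso_of_overIso (FN.frame x)
  obtain ⟨b, hb⟩ := PushforwardTransport.exists_frame_of_freeIso_restrict M (FM.U x) eM
  obtain ⟨c, hc⟩ := PushforwardTransport.exists_frame_of_freeIso_restrict N (FN.U x) eN
  have hb' : ∀ (V : X.Opens) (hV : V ≤ FM.U x ⊓ FN.U x), Function.Bijective
      fun a : FM.I x → Γ(X, V) => ∑ i, a i • M.presheaf.map (homOfLE hV).op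
        (M.presheaf.map (homOfLE (inf_le_left : FM.U x ⊓ FN.U x ≤ FM.U x)).op (b i)) := by
    intro V hV
    have h : ∀ i, M.presheaf.map (homOfLE hV).op
        (M.presheaf.map (homOfLE (inf_le_left : FM.U x ⊓ FN.U x ≤ FM.U x)).op (b i)) =
          M.presheaf.map (homOfLE (hV.trans inf_le_left)).op (b i) :=
      fun i => res_res M inf_le_left hV (b i)
    simp_rw [h]
    exact hb V (hV.trans inf_le_left)
  have hc' : ∀ (V : X.Opens) (hV : V ≤ FM.U x ⊓ FN.U x), Function.Bijective
      fun a : FN.I x → Γ(X, V) => ∑ i, a i • N.presheaf.map (homOfLE hV).op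
        (N.presheaf.map (homOfLE (inf_le_right : FM.U x ⊓ FN.U x ≤ FN.U x)).op (c i)) := by
    intro V hV
    have h : ∀ j, N.presheaf.map (homOfLE hV).op
        (N.presheaf.map (homOfLE (inf_le_right : FM.U x ⊓ FN.U x ≤ FN.U x)).op (c j)) =
          N.presheaf.map (homOfLE (hV.trans inf_le_right)).op (c j) :=
      fun j => res_res N inf_le_right hV (c j)
    simp_rw [h]
    exact hc V (hV.trans inf_le_right)
  exact ⟨FramePair.mk
    (fun i => M.presheaf.map (homOfLE (inf_le_left : FM.U x ⊓ FN.U x ≤ FM.U x)).op (b i))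
    (fun j => N.presheaf.map (homOfLE (inf_le_right : FM.U x ⊓ FN.U x ≤ FN.U x)).op (c j))
    hb' hc'⟩

/-- **A frame system of `M ⊗ N` from frame systems of `M` and `N`**, with index types
`I_M(x) × I_N(x)` and ranks `rank_M(x) · rank_N(x)`. [cite: StacksProject, Tag 01CE (Lemma 17.16.6 (7))] -/
theorem exists_frameSystem_tensorObj (FM : FrameSystem M) (FN : FrameSystem N) :
    ∃ F : FrameSystem (tensorObj M N), ∀ x, F.rank x = FM.rank x * FN.rank x := by
  classical
  have hx : ∀ x : X, Nonempty (SheafOfModules.free (FM.I x × FN.I x) ≅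
      (tensorObj M N).over (FM.U x ⊓ FN.U x)) := by
    intro x
    letI : Fintype (FM.I x) := Fintype.ofEquiv _ (FM.enum x).symm
    letI : Fintype (FN.I x) := Fintype.ofEquiv _ (FN.enum x).symm
    obtain ⟨P⟩ := nonempty_framePair_of_frameSystem M N FM FN x
    obtain ⟨t, ht⟩ := exists_frame_prod_tensorObj M N P
    obtain ⟨e⟩ := PushforwardTransport.nonempty_freeIso_restrict_of_frame (tensorObj M N)
      (FM.U x ⊓ FN.U x) t ht
    exact nonempty_overIso_of_restrictIso e
  refine ⟨{ U := fun x => FM.U x ⊓ FN.U x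
            mem := fun x => ⟨FM.mem x, FN.mem x⟩
            I := fun x => FM.I x × FN.I x
            rank := fun x => FM.rank x * FN.rank x
            enum := fun x => (Equiv.prodCongr (FM.enum x) (FN.enum x)).trans finProdFinEquiv
            frame := fun x => (hx x).some }, fun x => rfl⟩

variable {M N}

/-- **The tensor product of modules of ranks `r` and `r'` has rank `r r'`** (Stacks 01CE (7) with
ranks; Hartshorne II Ex. 5.16 (a)–(b): `𝒪^r ⊗ 𝒪^{r'} ≅ 𝒪^{r r'}` locally).
[cite: StacksProject, Tag 01CE (Lemma 17.16.6 (7))] -/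
theorem hasRank_tensorObj {r r' : ℕ} (hM : HasRank M r) (hN : HasRank N r') :
    HasRank (tensorObj M N) (r * r') := by
  obtain ⟨FM, hFM⟩ := exists_frameSystem_of_hasRank hM
  obtain ⟨FN, hFN⟩ := exists_frameSystem_of_hasRank hN
  obtain ⟨F, hF⟩ := exists_frameSystem_tensorObj M N FM FN
  exact F.hasRank (r * r') fun x => by rw [hF, hFM, hFN]

/-- The tensor product of modules of rank one has rank one. [cite: Hartshorne1977, II Ex. 6.11] -/
theorem hasRank_tensorObj_one (hM : HasRank M 1) (hN : HasRank N 1) :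
    HasRank (tensorObj M N) 1 := by
  simpa using hasRank_tensorObj hM hN

open scoped TensorProduct

/-! ### Frames with prescribed basis sections -/

/-- **The basis sections of a frame form a frame**: for `e : 𝒪^I ≅ E|_W` and `V ≤ W` the map
`a ↦ ∑ a_i b_i|_V`, `𝒪_X(V)^I → Γ(E, V)`, is bijective (the coordinates are its inverse).
[cite: Hartshorne1977, II.5 p. 109 (locally free sheaves)] -/
theorem basisSection_frame_bijective {E : X.Modules} {W V : X.Opens} {I : Type u} [Fintype I]
    (e : SheafOfModules.free I ≅ E.over W) (k : V ⟶ W) :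
    Function.Bijective fun a : I → Γ(X, V) => ∑ i, a i • E.presheaf.map k.op (basisSection e i) := by
  refine ⟨fun a a' h => funext fun j => ?_,
    fun s => ⟨fun i => coord e k s i, (eq_sum_coord_smul e k s).symm⟩⟩
  have hj := congrArg (fun s => coord e k s j) h
  simpa only [coord_sum_smul_basisSection] using hj

/-- **Sections forming a frame over `W` are the basis sections of a trivialisation `𝒪^I ≅ E|_W`**
(for `E|_W` free on the finite type `I`): the endomorphism `b_l ↦ t_l` of `E|_W` has an invertible
matrix in the frame (Hartshorne II.5: a basis change of a free module).
[cite: Hartshorne1977, II.5 p. 109 (locally free sheaves)] -/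
theorem exists_frame_basisSection_eq {E : X.Modules} {W : X.Opens} {I : Type u} [Fintype I]
    (e₀ : SheafOfModules.free I ≅ E.over W) (t : I → Γ(E, W))
    (ht : Function.Bijective fun a : I → Γ(X, W) => ∑ i, a i • t i) :
    ∃ e : SheafOfModules.free I ≅ E.over W, ∀ i, basisSection e i = t i := by
  classical
  choose a ha using fun j => ht.2 (basisSection e₀ j)
  -- the matrix `A` of the `t_l` in the frame `e₀`, and the matrix `B` of the `b_j` in the `t_i`
  let A : Matrix I I Γ(X, W) := Matrix.of fun m l => coord e₀ (𝟙 W) (t l) m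
  let B : Matrix I I Γ(X, W) := Matrix.of fun i j => a j i
  have hb : ∀ m, E.presheaf.map (𝟙 W).op (basisSection e₀ m) = basisSection e₀ m :=
    fun m => presheaf_map_id E _
  have htA : ∀ l, t l = ∑ m, A m l • E.presheaf.map (𝟙 W).op (basisSection e₀ m) := fun l =>
    eq_sum_coord_smul e₀ (𝟙 W) (t l)
  have hAB : A * B = 1 := by
    ext k j
    have hk := congrArg (fun s => coord e₀ (𝟙 W) s k) (ha j)
    simp only [coord_sum, coord_smul, coord_basisSection] at hk
    have hk' : ∑ x, a j x * coord e₀ (𝟙 W) (t x) k = if k = j then 1 else 0 :=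
      hk.trans (if_congr eq_comm rfl rfl)
    rw [Matrix.mul_apply, Matrix.one_apply, ← hk']
    exact Finset.sum_congr rfl fun i _ => mul_comm _ _
  have hBA : B * A = 1 := mul_eq_one_comm.mp hAB
  let ψ : E.over W ≅ E.over W :=
    { hom := matrixEnd e₀ (𝟙 W) A
      inv := matrixEnd e₀ (𝟙 W) B
      hom_inv_id := by rw [matrixEnd_comp, hBA, matrixEnd_one]
      inv_hom_id := by rw [matrixEnd_comp, hAB, matrixEnd_one] }
  refine ⟨e₀ ≪≫ ψ, fun i => ?_⟩
  unfold basisSection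
  rw [Iso.trans_hom, SheafOfModules.freeHomEquiv_comp_apply, overSectionsEquiv_sectionsMap']
  change appLE (matrixEnd e₀ (𝟙 W) A) (𝟙 W) (basisSection e₀ i) = t i
  rw [← hb i, appLE_matrixEnd_basisSection]
  exact (htA i).symm


/-! ### Frames of `M ⊗ N` on the sections `η(b_i ⊗ c_j)` -/

variable (M N)

/-- **The sections `η_U(b_i ⊗ c_j)` form a frame of `M ⊗ N` over `U`** for a frame pair `(b, c)`
of `(M, N)` over `U` (`exists_frame_prod_tensorObj` with the sections named).
[cite: StacksProject, Tag 01CE (Lemma 17.16.6 (7), proof)] -/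
theorem frame_prod_tensorObj_bijective {U : X.Opens} {I K : Type u} [Fintype I] [Fintype K]
    (F : FramePair M N U I K) (V : X.Opens) (hV : V ≤ U) :
    Function.Bijective fun a : I × K → Γ(X, V) =>
      ∑ p, a p • (tensorObj M N).presheaf.map (homOfLE hV).op
        ((tensorUnitHom M N).app (op U) (F.basis U le_rfl p)) := by
  have key : (fun a : I × K → Γ(X, V) =>
      ∑ p, a p • (tensorObj M N).presheaf.map (homOfLE hV).op
        ((tensorUnitHom M N).app (op U) (F.basis U le_rfl p))) =
      (fun q => (tensorUnitHom M N).app (op V) q) ∘ fun a : I × K → secRing X V =>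
        ∑ p, a p • F.basis V hV p := by
    funext a
    simp only [Function.comp_apply]
    rw [tensorUnitHom_app_sum]
    refine Finset.sum_congr rfl fun p _ => ?_
    rw [map_tensorUnitHom_app, F.resT_basis, tensorUnitHom_app_smul]
    rfl
  have hbij : Function.Bijective fun a : I × K → secRing X V => ∑ p, a p • F.basis V hV p := by
    have hsymm : (fun a : I × K → secRing X V => ∑ p, a p • F.basis V hV p) =
        ⇑(F.basis V hV).equivFun.symm :=
      funext fun a => ((F.basis V hV).equivFun_symm_apply a).symm
    rw [hsymm]
    exact (F.basis V hV).equivFun.symm.bijective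
  rw [key]
  exact (tensorUnitHom_app_bijective M N F V hV).comp hbij

/-- **A frame `𝒪^{I × K} ≅ (M ⊗ N)|_U` WITH BASIS SECTIONS `η_U(b_i ⊗ c_j)`** for a frame pair
`(b, c)` of `(M, N)` over `U` (Stacks 01CE (7): `𝒪^I ⊗ 𝒪^K ≅ 𝒪^{I × K}` on the product basis).
[cite: StacksProject, Tag 01CE (Lemma 17.16.6 (7), proof)] -/
theorem exists_frame_tensorObj_basisSection_eq {U : X.Opens} {I K : Type u} [Fintype I]
    [Fintype K] (F : FramePair M N U I K) :
    ∃ e : SheafOfModules.free (I × K) ≅ (tensorObj M N).over U,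
      ∀ p, basisSection e p = (tensorUnitHom M N).app (op U) (F.basis U le_rfl p) := by
  obtain ⟨e₁⟩ := PushforwardTransport.nonempty_freeIso_restrict_of_frame (tensorObj M N) U _
    (frame_prod_tensorObj_bijective M N F)
  obtain ⟨e₀⟩ := nonempty_overIso_of_restrictIso e₁
  have ht := frame_prod_tensorObj_bijective M N F U le_rfl
  have hid : ∀ p, (tensorObj M N).presheaf.map (homOfLE (le_refl U)).op
      ((tensorUnitHom M N).app (op U) (F.basis U le_rfl p)) =
        (tensorUnitHom M N).app (op U) (F.basis U le_rfl p) :=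
    fun p => presheaf_map_id (tensorObj M N) _
  simp only [hid] at ht
  exact exists_frame_basisSection_eq e₀ _ ht

variable {M N}

namespace FrameSystem

/-- **The tensor frame system of two RANK-ONE frame systems has cocycle `g_M · g_N`**: on
`U_M(x) ∩ U_N(x)` take the frame of `M ⊗ N` with basis section `η(b_x ⊗ c_x)`; since
`b_y| = g^M_{xy} b_x|` and `c_y| = g^N_{xy} c_x|`, bilinearity gives
`η(b_y ⊗ c_y)| = g^M_{xy} g^N_{xy} · η(b_x ⊗ c_x)|` (Hartshorne II Ex. 5.16 (d) in rank one /
Ex. 6.11: transition functions of `L ⊗ L'` are the products).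
[cite: Hartshorne1977, II Ex. 6.11 and II Ex. 5.16 (d)] -/
theorem exists_tensorObj_cocycle_equiv_mul (FM : FrameSystem M) (FN : FrameSystem N)
    (hM : ∀ x, FM.rank x = 1) (hN : ∀ x, FN.rank x = 1) :
    ∃ F : FrameSystem (tensorObj M N), (∀ x, F.rank x = 1) ∧
      UnitCocycle.Equiv F.cocycle (UnitCocycle.mul FM.cocycle FN.cocycle) := by
  classical
  have frames : ∀ x, ∃ e : SheafOfModules.free (FM.I x × FN.I x) ≅
      (tensorObj M N).over (FM.U x ⊓ FN.U x), ∀ i j,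
      basisSection e (i, j) = (tensorUnitHom M N).app (op (FM.U x ⊓ FN.U x))
        (res M inf_le_left (basisSection (FM.frame x) i) ⊗ₜ[secRing X (FM.U x ⊓ FN.U x)]
          res N inf_le_right (basisSection (FN.frame x) j)) := by
    intro x
    letI : Fintype (FM.I x) := Fintype.ofEquiv _ (FM.enum x).symm
    letI : Fintype (FN.I x) := Fintype.ofEquiv _ (FN.enum x).symm
    have hb : ∀ (V : X.Opens) (hV : V ≤ FM.U x ⊓ FN.U x), Function.Bijective
        fun a : FM.I x → Γ(X, V) => ∑ i, a i • M.presheaf.map (homOfLE hV).op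
          (M.presheaf.map (homOfLE (inf_le_left : FM.U x ⊓ FN.U x ≤ FM.U x)).op
            (basisSection (FM.frame x) i)) := by
      intro V hV
      have h : ∀ i, M.presheaf.map (homOfLE hV).op
          (M.presheaf.map (homOfLE (inf_le_left : FM.U x ⊓ FN.U x ≤ FM.U x)).op
            (basisSection (FM.frame x) i)) =
          M.presheaf.map (homOfLE (hV.trans inf_le_left)).op (basisSection (FM.frame x) i) :=
        fun i => res_res M inf_le_left hV _
      simp_rw [h]
      exact basisSection_frame_bijective (FM.frame x) (homOfLE (hV.trans inf_le_left))
    have hc : ∀ (V : X.Opens) (hV : V ≤ FM.U x ⊓ FN.U x), Function.Bijective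
        fun a : FN.I x → Γ(X, V) => ∑ j, a j • N.presheaf.map (homOfLE hV).op
          (N.presheaf.map (homOfLE (inf_le_right : FM.U x ⊓ FN.U x ≤ FN.U x)).op
            (basisSection (FN.frame x) j)) := by
      intro V hV
      have h : ∀ j, N.presheaf.map (homOfLE hV).op
          (N.presheaf.map (homOfLE (inf_le_right : FM.U x ⊓ FN.U x ≤ FN.U x)).op
            (basisSection (FN.frame x) j)) =
          N.presheaf.map (homOfLE (hV.trans inf_le_right)).op (basisSection (FN.frame x) j) :=
        fun j => res_res N inf_le_right hV _
      simp_rw [h]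
      exact basisSection_frame_bijective (FN.frame x) (homOfLE (hV.trans inf_le_right))
    obtain ⟨e, he⟩ := exists_frame_tensorObj_basisSection_eq M N (FramePair.mk _ _ hb hc)
    refine ⟨e, fun i j => ?_⟩
    rw [he, FramePair.basis_apply]
    change (tensorUnitHom M N).app (op (FM.U x ⊓ FN.U x))
        (res M le_rfl (res M inf_le_left (basisSection (FM.frame x) i)) ⊗ₜ[secRing X _]
          res N le_rfl (res N inf_le_right (basisSection (FN.frame x) j))) = _
    rw [res_res, res_res]
  choose frame hframe using frames
  refine ⟨{ U := fun x => FM.U x ⊓ FN.U x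
            mem := fun x => ⟨FM.mem x, FN.mem x⟩
            I := fun x => FM.I x × FN.I x
            rank := fun x => FM.rank x * FN.rank x
            enum := fun x => (Equiv.prodCongr (FM.enum x) (FN.enum x)).trans finProdFinEquiv
            frame := frame }, fun x => ?_, ?_⟩
  · change FM.rank x * FN.rank x = 1
    rw [hM x, hN x]
  refine UnitCocycle.equiv_of_eq _ _ (fun x => FM.U x ⊓ FN.U x) (fun x => ⟨FM.mem x, FN.mem x⟩)
    (fun x => le_rfl) (fun x => le_rfl) fun x y V hx hy => ?_
  haveI := FM.subsingleton_index hM x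
  haveI := FN.subsingleton_index hN x
  haveI := FM.subsingleton_index hM y
  haveI := FN.subsingleton_index hN y
  change FM.cocycle.g x y V _ _ * FN.cocycle.g x y V _ _ =
    transitionDet (frame x) (frame y) _ _ (homOfLE _) (homOfLE _)
  rw [transitionDet_eq_of_subsingleton (frame x) (frame y) _ _ _ _ (FM.idx hM x, FN.idx hN x)
    (FM.idx hM y, FN.idx hN y), transition_apply, hframe y, map_tensorUnitHom_app, resT_tmul,
    res_res, res_res]
  set gM : secRing X V := FM.cocycle.g x y V (hx.trans inf_le_left) (hy.trans inf_le_left)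
  set gN : secRing X V := FN.cocycle.g x y V (hx.trans inf_le_right) (hy.trans inf_le_right)
  have hb : res M (hy.trans inf_le_left) (basisSection (FM.frame y) (FM.idx hM y)) =
      gM • res M (hx.trans inf_le_left) (basisSection (FM.frame x) (FM.idx hM x)) :=
    FM.map_gen_eq hM _ _
  have hc : res N (hy.trans inf_le_right) (basisSection (FN.frame y) (FN.idx hN y)) =
      gN • res N (hx.trans inf_le_right) (basisSection (FN.frame x) (FN.idx hN x)) :=
    FN.map_gen_eq hN _ _
  have hx' : (tensorUnitHom M N).app (op V)
      (res M (hx.trans inf_le_left) (basisSection (FM.frame x) (FM.idx hM x)) ⊗ₜ[secRing X V]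
        res N (hx.trans inf_le_right) (basisSection (FN.frame x) (FN.idx hN x))) =
      (tensorObj M N).presheaf.map (homOfLE hx).op
        (basisSection (frame x) (FM.idx hM x, FN.idx hN x)) := by
    rw [hframe x, map_tensorUnitHom_app, resT_tmul, res_res, res_res]
  have hsm : (gM • res M (hx.trans inf_le_left) (basisSection (FM.frame x) (FM.idx hM x))) ⊗ₜ[secRing X V]
      (gN • res N (hx.trans inf_le_right) (basisSection (FN.frame x) (FN.idx hN x))) =
      (gM * gN) •
        (res M (hx.trans inf_le_left) (basisSection (FM.frame x) (FM.idx hM x)) ⊗ₜ[secRing X V]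
          res N (hx.trans inf_le_right) (basisSection (FN.frame x) (FN.idx hN x))) :=
    TensorProduct.smul_tmul_smul _ _ _ _
  rw [hb, hc, hsm, tensorUnitHom_app_smul]
  have hcs := coord_smul (frame x) (homOfLE hx) (gM * gN)
    ((tensorObj M N).presheaf.map (homOfLE hx).op
      (basisSection (frame x) (FM.idx hM x, FN.idx hN x))) (FM.idx hM x, FN.idx hN x)
  rw [coord_map_basisSection, if_pos rfl, mul_one, ← hx'] at hcs
  exact hcs.symm

end FrameSystem

/-! ### The determinant class of a tensor product of line bundles -/

/-- **`[det (L ⊗ L')] = [det L] · [det L']` for modules of rank one**: for `M`, `N` of rank one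
the determinant class of `M ⊗ N` (computed from ANY proof of finite local freeness,
`detClass_congr`) is the product of the determinant classes in `Ȟ¹(X, 𝒪_X^×)` — on a common
frame neighbourhood the transition scalar of `b ⊗ c` is the product of those of `b` and `c`
(`FrameSystem.exists_tensorObj_cocycle_equiv_mul`), and the class does not depend on the frame
system (`detClass_eq_mk`). [cite: Hartshorne1977, II Ex. 6.11 and II Ex. 5.16 (d)] -/
theorem detClass_tensorObj_of_hasRank_one (hM : HasRank M 1) (hN : HasRank N 1)
    (hM₁ : IsFiniteLocallyFree M) (hN₁ : IsFiniteLocallyFree N)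
    (hMN : IsFiniteLocallyFree (tensorObj M N)) :
    detClass hMN = detClass hM₁ * detClass hN₁ := by
  obtain ⟨FM, hFM⟩ := exists_frameSystem_of_hasRank hM
  obtain ⟨FN, hFN⟩ := exists_frameSystem_of_hasRank hN
  obtain ⟨F, -, hF⟩ := FrameSystem.exists_tensorObj_cocycle_equiv_mul FM FN hFM hFN
  rw [detClass_eq_mk hMN F, detClass_eq_mk hM₁ FM, detClass_eq_mk hN₁ FN, ← CechPic.mk_mul]
  exact CechPic.sound hF

/-- The same with the finite-local-freeness witnesses supplied by the rank hypotheses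
(`HasRank.isFiniteLocallyFree'`) and `isFiniteLocallyFree_tensorObj`.
[cite: Hartshorne1977, II Ex. 6.11 and II Ex. 5.16 (d)] -/
theorem detClass_tensorObj_of_hasRank_one' (hM : HasRank M 1) (hN : HasRank N 1) :
    detClass (isFiniteLocallyFree_tensorObj M N (HasRank.isFiniteLocallyFree' hM)
        (HasRank.isFiniteLocallyFree' hN)) =
      detClass (HasRank.isFiniteLocallyFree' hM) * detClass (HasRank.isFiniteLocallyFree' hN) :=
  detClass_tensorObj_of_hasRank_one hM hN _ _ _

end Literature.AlgebraicGeometry.Modules
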